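import Literature.Computability.Complexity.FKPointLocationSizes
import HarnessLib

/-!
# Fournier–Koiran point location, XI: the queried form is computed in polynomial time

Topic `Literature/Computability/Complexity`, grouping namespace `FKPointLocation`. `CodeFP`
realisations (maps computed on codes by `FP` string functions, `CodeFP.lean`) of the untyped form
computations of `FKPointLocationUntyped.lean`: vector primitives (`vget`, `udot`, `oneHot`,
`List.set`, `Int.sign`), the lift of a test through an apex (`uliftForm`, report §2.1 Lemma 2 /
Step k: "a test `h'` on `x^k` is done by performing the test `Aff(s_n^1, Aff(s_n^2, …))` on `x`"),
its iteration over the apex history (`uliftAll`, a left fold whose accumulator — the coefficients of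
the lifted form — grows additively in bit size, `affBnd_uliftForm`, hence stays polynomial,
`uliftAllFP`), the level-local forms (`ulocalForm`, dispatch on the task tag), the queried form
`uqueryForm` and the sign-query string handed to the sign oracle (`squery`).

## References

* H. Fournier, P. Koiran, *Lower bounds are not easier over the reals: inside PH*, ICALP 2000,
  LNCS 1853 = LIP RR-1999-21, §2.1 (Lemma 2, Steps 1 and k), §2.2 (polynomial size of the
  coefficients). [FournierKoiran2000]
* S. Arora, B. Barak, *Computational Complexity: A Modern Approach*, CUP 2009, §1.3. [AroraBarak2009]
-/

namespace Literature.Computability.Complexity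

namespace FKPointLocation

open _root_.Computability CodeFP Polynomial

/-! ### Encoders of forms, apex records, parameters -/

/-- Code of an untyped affine form. [folklore] -/
abbrev affE : UAff → List Bool := pairE vecE intE

/-- Code of an untyped apex record `(σ, d, i₀, ε)`. [folklore] -/
abbrev apexE : UApexRec → List Bool := pairE vecE (pairE natE (pairE natE intE))

/-- The fields of the parameter record, all in UNARY (they serve as loop budgets). [folklore] -/
def paramsFields (P : UParams) : List ℕ := [P.D, P.L, P.κ, P.W, P.bB, P.Wf, P.Wa]

/-- Code of the parameters. [folklore] -/
def paramsE : UParams → List Bool := fun P => rawE unE (paramsFields P)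

section Params

/-- Reading field `k` of the parameter record. [folklore] -/
private theorem pfield (k : ℕ) : CodeFP paramsE unE (fun P => (paramsFields P).getD k 0) :=
  ((rawGetD unE (d := 0) rfl).comp ((ofView (eγ := rawE unE) (t := paramsFields) (fun _ => rfl) (CodeFP.id _)).pair
    (const paramsE k))).congr fun _ => rfl

/-- The parameters, in unary. [folklore] -/
theorem params_D : CodeFP paramsE unE UParams.D := (pfield 0).congr fun _ => rfl
/-- The parameter `L` in unary, on codes. [folklore] -/
theorem params_L : CodeFP paramsE unE UParams.L := (pfield 1).congr fun _ => rfl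
/-- The parameter `κ` in unary, on codes. [folklore] -/
theorem params_κ : CodeFP paramsE unE UParams.κ := (pfield 2).congr fun _ => rfl
/-- The parameter `W` in unary, on codes. [folklore] -/
theorem params_W : CodeFP paramsE unE UParams.W := (pfield 3).congr fun _ => rfl
/-- The parameter `bB` in unary, on codes. [folklore] -/
theorem params_bB : CodeFP paramsE unE UParams.bB := (pfield 4).congr fun _ => rfl
/-- The parameter `Wf` in unary, on codes. [folklore] -/
theorem params_Wf : CodeFP paramsE unE UParams.Wf := (pfield 5).congr fun _ => rfl
/-- The parameter `Wa` in unary, on codes. [folklore] -/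
theorem params_Wa : CodeFP paramsE unE UParams.Wa := (pfield 6).congr fun _ => rfl

end Params

/-! ### Vector primitives -/

section Prims

variable {α : Type} {eα : α → List Bool}

/-- The sign of an integer. [folklore] -/
theorem intSign : CodeFP intE intE Int.sign :=
  (((intLt.comp ((const intE (0 : ℤ)).pair (CodeFP.id intE))).ite (const intE (1 : ℤ))
    ((intLt.comp ((CodeFP.id intE).pair (const intE (0 : ℤ)))).ite (const intE (-1 : ℤ)) (const intE (0 : ℤ)))).congr
    fun z => by
      simp only [id]
      rcases lt_trichotomy 0 z with h | rfl | h
      · simp [h, Int.sign_eq_one_of_pos h]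
      · simp
      · simp [h, Int.sign_eq_neg_one_of_neg h, not_lt.2 h.le])

/-- Reading a vector entry (default `0`). [folklore] -/
theorem vgetFP : CodeFP (pairE vecE natE) intE (fun p => vget p.1 p.2) :=
  ((rawGetOr intE).comp ((fst _ _).pair ((snd _ _).pair (const _ (0 : ℤ))))).congr fun _ => rfl

/-- Reading a bit entry (default `false`). [folklore] -/
theorem bgetFP : CodeFP (pairE (rawE bitE) natE) bitE (fun p => p.1.getD p.2 false) :=
  ((rawGetOr bitE).comp ((fst _ _).pair ((snd _ _).pair (const _ false)))).congr fun _ => rfl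

/-- The dot product. [folklore] -/
theorem udotFP : CodeFP (pairE vecE vecE) intE (fun p => udot p.1 p.2) := by
  have hz := (zipWith (σ := Unit) (eσ := unitE) (eα := intE) (eβ := intE) (eγ := intE)
    (g := fun t => t.2.1 * t.2.2) (intMul.comp ((snd _ _).fst'.pair (snd _ _).snd')) :)
  exact (intSum.comp (hz.comp ((const (pairE vecE vecE) ()).pair (CodeFP.id _)))).congr fun _ => rfl

/-- `set` is a map over the indexed items. [folklore] -/
theorem set_eq_map_enum (l : List α) (i : ℕ) (v : α) :
    l.set i v = ((List.range l.length).zip l).map (fun q => if q.1 = i then v else q.2) := by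
  apply List.ext_getElem (by simp)
  intro j h₁ h₂
  rw [List.getElem_set]
  simp only [List.getElem_map, List.getElem_zip, List.getElem_range]
  by_cases h : i = j
  · subst h; simp
  · rw [if_neg h, if_neg (Ne.symm h)]

/-- **Updating an entry of a raw list** at a binary index. [cite: AroraBarak2009, §1.3] -/
theorem rawSet (eα : α → List Bool) : CodeFP (pairE (rawE eα) (pairE natE eα)) (rawE eα) (fun p => p.1.set p.2.1 p.2.2) := by
  have hg : CodeFP (pairE (pairE natE eα) (pairE natE eα)) eα
      (fun t => if t.2.1 = t.1.1 then t.1.2 else t.2.2) :=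
    ((natEq.comp ((snd _ _).fst'.pair (fst _ _).fst')).ite ((fst _ _).snd') ((snd _ _).snd')).congr fun t => by
      simp only [decide_eq_true_eq]
  refine ((map hg).comp ((snd _ _).pair ((rawEnum eα).comp (fst _ _)))).congr fun p => ?_
  rw [set_eq_map_enum]

/-- The zero vector of a unary length. [folklore] -/
theorem zeroVec : CodeFP unE vecE (fun D => List.replicate D (0 : ℤ)) :=
  ((map₀ (const unitE (0 : ℤ))).comp replicateUnit).congr fun D => by simp

/-- One-hot vectors. [folklore] -/
theorem oneHotFP : CodeFP (pairE unE (pairE natE intE)) vecE (fun p => oneHot p.1 p.2.1 p.2.2) :=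
  ((rawSet intE).comp ((zeroVec.comp (fst _ _)).pair (snd _ _))).congr fun _ => rfl

/-- `signOf`. [folklore] -/
theorem signOfFP : CodeFP (pairE bitE bitE) intE (fun p => signOf p.1 p.2) :=
  (((fst _ _).ite ((snd bitE bitE).ite (const _ (0 : ℤ)) (const _ (1 : ℤ))) (const _ (-1 : ℤ))) :
    CodeFP (pairE bitE bitE) intE (fun p => if p.1 then (if p.2 then 0 else 1) else -1)).congr fun p => by
      unfold signOf; rfl

/-- `usignAt`. [folklore] -/
theorem usignAtFP : CodeFP (pairE (rawE bitE) (pairE (rawE bitE) natE)) intE (fun p => usignAt p.1 p.2.1 p.2.2) :=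
  (signOfFP.comp ((bgetFP.comp ((fst _ _).pair (snd _ _).snd')).pair (bgetFP.comp ((snd _ _).fst'.pair (snd _ _).snd')))).congr
    fun _ => rfl

end Prims

/-! ### The lift through an apex -/

section Lift

/-- The context of the coefficient map of `uliftForm`: `(τ, E d, i₀, Aσ d, a)`. [folklore] -/
private abbrev LCtx : Type := ℤ × ℤ × ℕ × ℤ × List ℤ
/-- Code of the lift context. [folklore] -/
private abbrev lctxE : LCtx → List Bool := pairE intE (pairE intE (pairE natE (pairE intE vecE)))

/-- The coefficient map of `uliftForm`. [folklore] -/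
private theorem liftCoeff : CodeFP (pairE lctxE natE) intE
    (fun t => t.1.1 * (t.1.2.1 * vget t.1.2.2.2.2 t.2 + if t.2 = t.1.2.2.1 then t.1.2.2.2.1 else 0)) := by
  have hτ : CodeFP (pairE lctxE natE) intE (fun t => t.1.1) := (fst _ _).fst'
  have hEd : CodeFP (pairE lctxE natE) intE (fun t => t.1.2.1) := (fst _ _).snd'.fst'
  have hi₀ : CodeFP (pairE lctxE natE) natE (fun t => t.1.2.2.1) := (fst _ _).snd'.snd'.fst'
  have hAd : CodeFP (pairE lctxE natE) intE (fun t => t.1.2.2.2.1) := (fst _ _).snd'.snd'.snd'.fst'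
  have ha : CodeFP (pairE lctxE natE) vecE (fun t => t.1.2.2.2.2) := (fst _ _).snd'.snd'.snd'.snd'
  have hk : CodeFP (pairE lctxE natE) natE (fun t => t.2) := snd _ _
  have hif : CodeFP (pairE lctxE natE) intE (fun t => if t.2 = t.1.2.2.1 then t.1.2.2.2.1 else 0) :=
    ((natEq.comp (hk.pair hi₀)).ite hAd (const _ (0 : ℤ))).congr fun t => by simp only [decide_eq_true_eq]
  exact (intMul.comp (hτ.pair (intAdd.comp ((intMul.comp (hEd.pair (vgetFP.comp (ha.pair hk)))).pair hif))) :)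

set_option maxHeartbeats 800000 in
/-- **The lift of a form through an apex is computed in polynomial time.** [cite: FournierKoiran2000, §2.1 Lemma 2] -/
theorem uliftFormFP : CodeFP (pairE apexE affE) affE (fun p => uliftForm p.1 p.2) := by
  -- the named quantities
  have hσ : CodeFP (pairE apexE affE) vecE (fun p => p.1.1) := (fst _ _).fst'
  have hd : CodeFP (pairE apexE affE) intE (fun p => (p.1.2.1 : ℤ)) := (intOfNat.comp (fst _ _).snd'.fst' :)
  have hi₀ : CodeFP (pairE apexE affE) natE (fun p => p.1.2.2.1) := (fst _ _).snd'.snd'.fst'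
  have hε : CodeFP (pairE apexE affE) intE (fun p => p.1.2.2.2) := (fst _ _).snd'.snd'.snd'
  have ha : CodeFP (pairE apexE affE) vecE (fun p => p.2.1) := (snd _ _).fst'
  have hc : CodeFP (pairE apexE affE) intE (fun p => p.2.2) := (snd _ _).snd'
  have hS : CodeFP (pairE apexE affE) intE (fun p => udot p.2.1 p.1.1) := (udotFP.comp (ha.pair hσ) :)
  have hAσ : CodeFP (pairE apexE affE) intE (fun p => udot p.2.1 p.1.1 + p.2.2 * (p.1.2.1 : ℤ)) :=
    (intAdd.comp (hS.pair (intMul.comp (hc.pair hd))) :)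
  have hE : CodeFP (pairE apexE affE) intE (fun p => p.1.2.2.2 * (p.1.2.1 : ℤ) - vget p.1.1 p.1.2.2.1) :=
    (intSub.comp ((intMul.comp (hε.pair hd)).pair (vgetFP.comp (hσ.pair hi₀))) :)
  have hτ : CodeFP (pairE apexE affE) intE (fun p => (p.1.2.2.2 * (p.1.2.1 : ℤ) - vget p.1.1 p.1.2.2.1).sign) :=
    (intSign.comp hE :)
  -- the coefficients: a map over `range |a|` with context `(τ, E d, i₀, Aσ d, a)`
  have hctx : CodeFP (pairE apexE affE) lctxE (fun p =>
      ((p.1.2.2.2 * (p.1.2.1 : ℤ) - vget p.1.1 p.1.2.2.1).sign,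
        (p.1.2.2.2 * (p.1.2.1 : ℤ) - vget p.1.1 p.1.2.2.1) * (p.1.2.1 : ℤ), p.1.2.2.1,
        (udot p.2.1 p.1.1 + p.2.2 * (p.1.2.1 : ℤ)) * (p.1.2.1 : ℤ), p.2.1)) :=
    (hτ.pair ((intMul.comp (hE.pair hd)).pair (hi₀.pair ((intMul.comp (hAσ.pair hd)).pair ha))) :)
  have hrange : CodeFP (pairE apexE affE) (rawE natE) (fun p => List.range p.2.1.length) :=
    (urange.comp ((ulength intE).comp ha) :)
  have hcoeffs := ((map liftCoeff).comp (hctx.pair hrange) :)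
  have hconst : CodeFP (pairE apexE affE) intE (fun p =>
      (p.1.2.2.2 * (p.1.2.1 : ℤ) - vget p.1.1 p.1.2.2.1).sign *
        (-((udot p.2.1 p.1.1 + p.2.2 * (p.1.2.1 : ℤ)) * vget p.1.1 p.1.2.2.1) -
          (p.1.2.2.2 * (p.1.2.1 : ℤ) - vget p.1.1 p.1.2.2.1) * udot p.2.1 p.1.1)) :=
    (intMul.comp (hτ.pair (intSub.comp ((intNeg.comp (intMul.comp (hAσ.pair (vgetFP.comp (hσ.pair hi₀))))).pair
      (intMul.comp (hE.pair hS))))) :)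
  refine ((hcoeffs.pair hconst).congr fun p => ?_)
  obtain ⟨⟨σ, d, i₀, ε⟩, ⟨a, c⟩⟩ := p
  simp only [uliftForm]

end Lift

/-! ### Sizes under the lift -/

section LiftBounds

/-- Bounded forms. [folklore] -/
def AffBnd (M : ℕ) (φ : UAff) : Prop := (∀ a ∈ φ.1, a.natAbs < 2 ^ M) ∧ φ.2.natAbs < 2 ^ M

/-- Bounded apex records. [folklore] -/
def ApexBnd (M : ℕ) (A : UApexRec) : Prop := (∀ a ∈ A.1, a.natAbs < 2 ^ M) ∧ A.2.1 < 2 ^ M ∧ A.2.2.2.natAbs < 2 ^ M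

/-- Weakening the exponent. [folklore] -/
theorem AffBnd.mono {M M' : ℕ} {φ : UAff} (h : AffBnd M φ) (hM : M ≤ M') : AffBnd M' φ :=
  ⟨fun a ha => lt_of_lt_of_le (h.1 a ha) (Nat.pow_le_pow_right (by norm_num) hM),
    lt_of_lt_of_le h.2 (Nat.pow_le_pow_right (by norm_num) hM)⟩

/-- Products of bounded integers. [folklore] -/
theorem natAbs_mul_lt {a b : ℤ} {x y : ℕ} (ha : a.natAbs < 2 ^ x) (hb : b.natAbs < 2 ^ y) :
    (a * b).natAbs < 2 ^ (x + y) := by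
  rw [Int.natAbs_mul, pow_add]
  exact Nat.mul_lt_mul'' ha hb

/-- Sums of bounded integers. [folklore] -/
theorem natAbs_add_lt {a b : ℤ} {x : ℕ} (ha : a.natAbs < 2 ^ x) (hb : b.natAbs < 2 ^ x) :
    (a + b).natAbs < 2 ^ (x + 1) := by
  have := Int.natAbs_add_le a b
  rw [pow_succ]; omega

/-- Differences of bounded integers. [folklore] -/
theorem natAbs_sub_lt {a b : ℤ} {x : ℕ} (ha : a.natAbs < 2 ^ x) (hb : b.natAbs < 2 ^ x) :
    (a - b).natAbs < 2 ^ (x + 1) := by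
  have := Int.natAbs_sub_le a b
  rw [pow_succ]; omega

/-- Weakening an exponent. [folklore] -/
theorem natAbs_lt_mono {a : ℤ} {x y : ℕ} (h : a.natAbs < 2 ^ x) (hxy : x ≤ y) : a.natAbs < 2 ^ y :=
  lt_of_lt_of_le h (Nat.pow_le_pow_right (by norm_num) hxy)

/-- `vget` of a bounded vector. [folklore] -/
theorem natAbs_vget_lt {l : List ℤ} {M : ℕ} (h : ∀ a ∈ l, a.natAbs < 2 ^ M) (i : ℕ) : (vget l i).natAbs < 2 ^ M := by
  unfold vget
  rw [List.getD_eq_getElem?_getD]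
  rcases hgi : l[i]? with _ | a
  · simp
  · simpa using h a (List.mem_of_getElem? hgi)

/-- The dot product of bounded vectors: `|a·σ| ≤ |a| 2^{Ma+Mσ}`, hence `< 2^{Ma+Mσ+size |a|}`. [folklore] -/
theorem natAbs_udot_lt {a σ : List ℤ} {Ma Mσ : ℕ} (ha : ∀ x ∈ a, x.natAbs < 2 ^ Ma) (hσ : ∀ x ∈ σ, x.natAbs < 2 ^ Mσ) :
    (udot a σ).natAbs < 2 ^ (Ma + Mσ + Nat.size a.length) := by
  unfold udot
  have hitems : ∀ z ∈ List.zipWith (· * ·) a σ, z.natAbs ≤ 2 ^ (Ma + Mσ) := by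
    intro z hz
    obtain ⟨x, hx, y, hy, rfl⟩ := exists_of_mem_zipWith hz
    exact (natAbs_mul_lt (ha x hx) (hσ y hy)).le
  have hsum : (List.zipWith (· * ·) a σ).sum.natAbs ≤ (List.zipWith (· * ·) a σ).length * 2 ^ (Ma + Mσ) := by
    refine (natAbs_sum_le _).trans ?_
    calc ((List.zipWith (· * ·) a σ).map Int.natAbs).sum ≤ ((List.zipWith (· * ·) a σ).map fun _ => 2 ^ (Ma + Mσ)).sum :=
          List.sum_le_sum fun z hz => hitems z hz
      _ = _ := by rw [List.map_const', List.sum_replicate, smul_eq_mul]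
  have hlen : (List.zipWith (· * ·) a σ).length ≤ a.length := by
    rw [List.length_zipWith]; exact min_le_left _ _
  calc (List.zipWith (· * ·) a σ).sum.natAbs ≤ a.length * 2 ^ (Ma + Mσ) := hsum.trans (Nat.mul_le_mul_right _ hlen)
    _ < 2 ^ Nat.size a.length * 2 ^ (Ma + Mσ) := Nat.mul_lt_mul_of_lt_of_le (Nat.lt_size_self _) le_rfl (by positivity)
    _ = 2 ^ (Ma + Mσ + Nat.size a.length) := by rw [← pow_add]; ring_nf

/-- `uliftForm` preserves the number of coefficients. [folklore] -/
theorem length_uliftForm (A : UApexRec) (φ : UAff) : (uliftForm A φ).1.length = φ.1.length := by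
  simp [uliftForm]

/-- **Additive growth of the coefficient size under one lift**: from `AffBnd Mφ φ` and `ApexBnd MA A`
to `AffBnd (Mφ + 3 MA + size |φ| + 2) (uliftForm A φ)`. [cite: FournierKoiran2000, §2.2 (the coefficients stay of polynomial length)] -/
theorem affBnd_uliftForm {Mφ MA : ℕ} {φ : UAff} {A : UApexRec} (hφ : AffBnd Mφ φ) (hA : ApexBnd MA A) :
    AffBnd (Mφ + 3 * MA + Nat.size φ.1.length + 2) (uliftForm A φ) := by
  obtain ⟨σ, d, i₀, ε⟩ := A
  obtain ⟨a, c⟩ := φ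
  obtain ⟨hσ, hd, hε⟩ := hA
  obtain ⟨ha, hc⟩ := hφ
  simp only at hσ hd hε ha hc ⊢
  set sl := Nat.size a.length with hsl
  have hdI : ((d : ℤ)).natAbs < 2 ^ MA := by simpa using hd
  have hS : (udot a σ).natAbs < 2 ^ (Mφ + MA + sl) := natAbs_udot_lt ha hσ
  have hcd : (c * (d : ℤ)).natAbs < 2 ^ (Mφ + MA) := natAbs_mul_lt hc hdI
  have hAσ : (udot a σ + c * (d : ℤ)).natAbs < 2 ^ (Mφ + MA + sl + 1) :=
    natAbs_add_lt hS (natAbs_lt_mono hcd (by omega))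
  have hσi : (vget σ i₀).natAbs < 2 ^ MA := natAbs_vget_lt hσ i₀
  have hE : (ε * (d : ℤ) - vget σ i₀).natAbs < 2 ^ (2 * MA + 1) :=
    natAbs_sub_lt (by have := natAbs_mul_lt hε hdI; rwa [two_mul]) (natAbs_lt_mono hσi (by omega))
  have hτ : ((ε * (d : ℤ) - vget σ i₀).sign).natAbs ≤ 1 := by
    rcases Int.sign_trichotomy (ε * (d : ℤ) - vget σ i₀) with h | h | h <;> rw [h] <;> simp
  have hτmul : ∀ (z : ℤ) (x : ℕ), z.natAbs < 2 ^ x → ((ε * (d : ℤ) - vget σ i₀).sign * z).natAbs < 2 ^ x := by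
    intro z x hz
    rw [Int.natAbs_mul]
    calc _ ≤ 1 * z.natAbs := Nat.mul_le_mul_right _ hτ
      _ < 2 ^ x := by rw [one_mul]; exact hz
  constructor
  · intro x hx
    simp only [uliftForm, List.mem_map, List.mem_range] at hx
    obtain ⟨k, _, rfl⟩ := hx
    apply hτmul
    have hak : (vget a k).natAbs < 2 ^ Mφ := natAbs_vget_lt ha k
    have h1 : ((ε * (d : ℤ) - vget σ i₀) * (d : ℤ) * vget a k).natAbs < 2 ^ (Mφ + 3 * MA + sl + 1) :=
      natAbs_lt_mono (natAbs_mul_lt (natAbs_mul_lt hE hdI) hak) (by omega)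
    have h2 : (if k = i₀ then (udot a σ + c * (d : ℤ)) * (d : ℤ) else 0).natAbs < 2 ^ (Mφ + 3 * MA + sl + 1) := by
      split_ifs
      · exact natAbs_lt_mono (natAbs_mul_lt hAσ hdI) (by omega)
      · simp
    have := natAbs_add_lt h1 h2
    exact natAbs_lt_mono this (by omega)
  · simp only [uliftForm]
    apply hτmul
    have h1 : (-((udot a σ + c * (d : ℤ)) * vget σ i₀)).natAbs < 2 ^ (Mφ + 3 * MA + sl + 1) := by
      rw [Int.natAbs_neg]; exact natAbs_lt_mono (natAbs_mul_lt hAσ hσi) (by omega)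
    have h2 : ((ε * (d : ℤ) - vget σ i₀) * udot a σ).natAbs < 2 ^ (Mφ + 3 * MA + sl + 1) :=
      natAbs_lt_mono (natAbs_mul_lt hE hS) (by omega)
    exact natAbs_lt_mono (natAbs_sub_lt h1 h2) (by omega)

/-- Entries of a coded vector are below `2^{|code|}`. [folklore] -/
theorem natAbs_lt_of_mem_vec {l : List ℤ} {N : ℕ} (hN : (vecE l).length ≤ N) : ∀ a ∈ l, a.natAbs < 2 ^ N := by
  intro a ha
  refine lt_of_lt_of_le (Nat.lt_size_self _) (Nat.pow_le_pow_right (by norm_num) ?_)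
  refine (size_natAbs_le_length_intE a).trans ?_
  have := length_item_le_length_rawE intE ha
  change 2 * (intE a).length + 2 ≤ (vecE l).length at this
  omega

/-- A coded integer is below `2^{|code|}`. [folklore] -/
theorem natAbs_lt_of_intE {z : ℤ} {N : ℕ} (hN : (intE z).length ≤ N) : z.natAbs < 2 ^ N :=
  lt_of_lt_of_le (Nat.lt_size_self _) (Nat.pow_le_pow_right (by norm_num) ((size_natAbs_le_length_intE z).trans hN))

/-- The bound along the fold: after lifting a form with `AffBnd M` through apexes with `ApexBnd N`
(and `size |φ| ≤ N`), the result has `AffBnd (M + |l| (4N + 2))` and the same length.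
[cite: FournierKoiran2000, §2.2] -/
theorem affBnd_foldl {N : ℕ} : ∀ {M : ℕ} {φ : UAff}, AffBnd M φ → Nat.size φ.1.length ≤ N →
    ∀ (l : List UApexRec), (∀ A ∈ l, ApexBnd N A) →
      AffBnd (M + l.length * (4 * N + 2)) (l.foldl (fun ψ A => uliftForm A ψ) φ) ∧
        (l.foldl (fun ψ A => uliftForm A ψ) φ).1.length = φ.1.length
  | M, φ, hφ, _, [], _ => ⟨by simpa using hφ, rfl⟩
  | M, φ, hφ, hlen, A :: l, hl => by
    rw [List.foldl_cons]
    have hA := hl A (by simp)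
    have h1 := affBnd_uliftForm hφ hA
    have hlen1 : (uliftForm A φ).1.length = φ.1.length := length_uliftForm A φ
    have h1' : AffBnd (M + (4 * N + 2)) (uliftForm A φ) := h1.mono (by omega)
    have ih := affBnd_foldl h1' (by rw [hlen1]; exact hlen) l (fun B hB => hl B (by simp [hB]))
    refine ⟨ih.1.mono (le_of_eq ?_), ih.2.trans hlen1⟩
    simp only [List.length_cons]
    ring

/-- Length of the code of a bounded form. [folklore] -/
theorem length_affE_le {M : ℕ} {φ : UAff} (h : AffBnd M φ) : (affE φ).length ≤ 2 * (φ.1.length * (6 * M + 6)) + 3 * M + 4 := by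
  have h1 := length_vecE_le h.1
  have h2 := (length_intE_le φ.2).trans (by have := size_le_of_lt_two_pow h.2; omega : 3 * Nat.size φ.2.natAbs + 2 ≤ 3 * M + 2)
  simp only [pairE_apply, length_boolPair]
  omega

/-- **Lifting through the whole apex history is computed in polynomial time** (a left fold with a
polynomially bounded accumulator). [cite: FournierKoiran2000, §2.1 Step k, §2.2] -/
theorem uliftAllFP : CodeFP (pairE affE (rawE apexE)) affE (fun p => uliftAll p.2 p.1) := by
  have hstep : CodeFP (pairE affE (pairE apexE affE)) affE (fun t => uliftForm t.2.1 t.2.2) := (uliftFormFP.comp (snd _ _) :)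
  have h := foldl (σ := UAff) (α := UApexRec) (β := UAff) (eσ := affE) (eα := apexE) (eβ := affE)
    (step := fun _ A ψ => uliftForm A ψ) (init := fun φ => φ) hstep (CodeFP.id affE)
    (48 * X ^ 3 + 48 * X ^ 2 + 21 * X + 6) (fun φ l₁ l₂ => by
      set N := (pairE affE (rawE apexE) (φ, l₁ ++ l₂)).length with hN
      have hN' : N = 2 * (affE φ).length + 2 + (rawE apexE (l₁ ++ l₂)).length := by
        rw [hN, pairE_apply, length_boolPair]
      have haff : (affE φ).length = 2 * (vecE φ.1).length + 2 + (intE φ.2).length := by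
        simp only [pairE_apply, length_boolPair]
      have hvec : (vecE φ.1).length ≤ N := by omega
      have hφ : AffBnd N φ := ⟨natAbs_lt_of_mem_vec hvec, natAbs_lt_of_intE (by omega)⟩
      have hlenφ : φ.1.length ≤ N := (length_le_length_rawE intE φ.1).trans hvec
      have hsl : Nat.size φ.1.length ≤ N := (size_mono hlenφ).trans (Nat.size_le.2 Nat.lt_two_pow_self)
      have hitems : ∀ A ∈ l₁, ApexBnd N A := by
        intro A hA
        have hAc : 2 * (apexE A).length + 2 ≤ (rawE apexE (l₁ ++ l₂)).length :=
          length_item_le_length_rawE apexE (List.mem_append_left l₂ hA)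
        have hAN : (apexE A).length ≤ N := by omega
        obtain ⟨σ, d, i₀, ε⟩ := A
        have hAe : (apexE (σ, d, i₀, ε)).length = 2 * (vecE σ).length + 2 + (2 * (natE d).length + 2 +
            (2 * (natE i₀).length + 2 + (intE ε).length)) := by simp only [pairE_apply, length_boolPair]
        refine ⟨natAbs_lt_of_mem_vec (l := σ) (by omega), ?_, natAbs_lt_of_intE (z := ε) (by omega)⟩
        calc d < 2 ^ Nat.size d := Nat.lt_size_self _
          _ ≤ 2 ^ N := Nat.pow_le_pow_right (by norm_num) (by rw [← length_natE]; omega)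
      have hl₁ : l₁.length ≤ N := by
        calc l₁.length ≤ (l₁ ++ l₂).length := by simp
          _ ≤ (rawE apexE (l₁ ++ l₂)).length := length_le_length_rawE _ _
          _ ≤ N := by omega
      obtain ⟨hB, hL⟩ := affBnd_foldl hφ hsl l₁ hitems
      have hB' : AffBnd (4 * N ^ 2 + 3 * N) (l₁.foldl (fun ψ A => uliftForm A ψ) φ) :=
        hB.mono (by nlinarith [hl₁])
      refine (length_affE_le hB').trans ?_
      rw [hL]
      simp only [eval_add, eval_mul, eval_pow, eval_X, eval_ofNat]
      nlinarith [hlenφ, Nat.zero_le N])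
  exact (h.comp ((fst _ _).pair (snd _ _))).congr fun p => rfl

end LiftBounds

/-! ### The level-local forms -/

section Local

/-- The input of the form computations: parameters, state, task. [folklore] -/
abbrev LIn : Type := UParams × UData × UTask

/-- Its code. [folklore] -/
abbrev linE : LIn → List Bool := pairE paramsE (pairE dataE taskE)

/-- `2^{min k L}` in binary from binary `k` and unary `L`, as an integer. [folklore] -/
theorem powMinFP : CodeFP (pairE natE unE) intE (fun p => ((2 ^ min p.1 p.2 : ℕ) : ℤ)) :=
  (intOfNat.comp (natPow.comp ((const _ (2 : ℕ)).pair (unOfNatMin.comp ((snd _ _).pair (fst _ _)))))).congr fun p => by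
    simp

set_option maxHeartbeats 800000 in
/-- `ubsForm` at a clamped round: input `(D, i, k, L, acc)`. [cite: FournierKoiran2000, §2.1 Step 1] -/
theorem ubsFormFP : CodeFP (pairE unE (pairE natE (pairE natE (pairE unE natE)))) affE
    (fun p => ubsForm p.1 p.2.1 (min p.2.2.1 p.2.2.2.1) p.2.2.2.2) := by
  have hD : CodeFP (pairE unE (pairE natE (pairE natE (pairE unE natE)))) unE (fun p => p.1) := fst _ _
  have hi : CodeFP (pairE unE (pairE natE (pairE natE (pairE unE natE)))) natE (fun p => p.2.1) := (snd _ _).fst'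
  have hpow : CodeFP (pairE unE (pairE natE (pairE natE (pairE unE natE)))) intE
      (fun p => ((2 ^ min p.2.2.1 p.2.2.2.1 : ℕ) : ℤ)) := (powMinFP.comp ((snd _ _).snd'.fst'.pair (snd _ _).snd'.snd'.fst') :)
  have hacc : CodeFP (pairE unE (pairE natE (pairE natE (pairE unE natE)))) intE (fun p => (p.2.2.2.2 : ℤ)) :=
    (intOfNat.comp (snd _ _).snd'.snd'.snd' :)
  refine (((oneHotFP.comp (hD.pair (hi.pair hpow))).pair
    (intSub.comp ((intSub.comp (hpow.pair (intMul.comp ((const _ (2 : ℤ)).pair hacc)))).pair (const _ (1 : ℤ)))) :)).congr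
    fun p => ?_
  simp only [ubsForm]
  push_cast
  rfl

/-- `ugeForm`: input `(D, apexN, apexD, i)`. [folklore] -/
theorem ugeFormFP : CodeFP (pairE unE (pairE vecE (pairE natE natE))) affE (fun p => ugeForm p.1 p.2.1 p.2.2.1 p.2.2.2) := by
  have hD : CodeFP (pairE unE (pairE vecE (pairE natE natE))) unE (fun p => p.1) := fst _ _
  have hN : CodeFP (pairE unE (pairE vecE (pairE natE natE))) vecE (fun p => p.2.1) := (snd _ _).fst'
  have hd : CodeFP (pairE unE (pairE vecE (pairE natE natE))) intE (fun p => (p.2.2.1 : ℤ)) := (intOfNat.comp (snd _ _).snd'.fst' :)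
  have hi : CodeFP (pairE unE (pairE vecE (pairE natE natE))) natE (fun p => p.2.2.2) := (snd _ _).snd'.snd'
  exact (((oneHotFP.comp (hD.pair (hi.pair hd))).pair (intNeg.comp (vgetFP.comp (hN.pair hi))) :)).congr fun _ => rfl

/-- `uleForm`: input `(D, apexN, apexD, i)`. [folklore] -/
theorem uleFormFP : CodeFP (pairE unE (pairE vecE (pairE natE natE))) affE (fun p => uleForm p.1 p.2.1 p.2.2.1 p.2.2.2) := by
  have hD : CodeFP (pairE unE (pairE vecE (pairE natE natE))) unE (fun p => p.1) := fst _ _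
  have hN : CodeFP (pairE unE (pairE vecE (pairE natE natE))) vecE (fun p => p.2.1) := (snd _ _).fst'
  have hd : CodeFP (pairE unE (pairE vecE (pairE natE natE))) intE (fun p => (p.2.2.1 : ℤ)) := (intOfNat.comp (snd _ _).snd'.fst' :)
  have hi : CodeFP (pairE unE (pairE vecE (pairE natE natE))) natE (fun p => p.2.2.2) := (snd _ _).snd'.snd'
  exact (((oneHotFP.comp (hD.pair (hi.pair (intNeg.comp hd)))).pair (vgetFP.comp (hN.pair hi)) :)).congr fun _ => rfl

/-- The input of `ufaForm`: `(D, apexN, apexD, εc, εi, c, i)`. [folklore] -/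
private abbrev FaIn : Type := ℕ × List ℤ × ℕ × ℤ × ℤ × ℕ × ℕ
/-- Code of the facet-form input. [folklore] -/
private abbrev faInE : FaIn → List Bool := pairE unE (pairE vecE (pairE natE (pairE intE (pairE intE (pairE natE natE)))))

set_option maxHeartbeats 800000 in
/-- `ufaForm`. [cite: FournierKoiran2000, §2.1] -/
theorem ufaFormFP : CodeFP faInE affE (fun p => ufaForm p.1 p.2.1 p.2.2.1 p.2.2.2.1 p.2.2.2.2.1 p.2.2.2.2.2.1 p.2.2.2.2.2.2) := by
  have hD : CodeFP faInE unE (fun p => p.1) := fst _ _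
  have hN : CodeFP faInE vecE (fun p => p.2.1) := (snd _ _).fst'
  have hd : CodeFP faInE intE (fun p => (p.2.2.1 : ℤ)) := (intOfNat.comp (snd _ _).snd'.fst' :)
  have hεc : CodeFP faInE intE (fun p => p.2.2.2.1) := (snd _ _).snd'.snd'.fst'
  have hεi : CodeFP faInE intE (fun p => p.2.2.2.2.1) := (snd _ _).snd'.snd'.snd'.fst'
  have hc : CodeFP faInE natE (fun p => p.2.2.2.2.2.1) := (snd _ _).snd'.snd'.snd'.snd'.fst'
  have hi : CodeFP faInE natE (fun p => p.2.2.2.2.2.2) := (snd _ _).snd'.snd'.snd'.snd'.snd'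
  have hNc : CodeFP faInE intE (fun p => vget p.2.1 p.2.2.2.2.2.1) := (vgetFP.comp (hN.pair hc) :)
  have hNi : CodeFP faInE intE (fun p => vget p.2.1 p.2.2.2.2.2.2) := (vgetFP.comp (hN.pair hi) :)
  have hνc : CodeFP faInE intE (fun p => (p.2.2.1 : ℤ) - p.2.2.2.1 * vget p.2.1 p.2.2.2.2.2.1) :=
    (intSub.comp (hd.pair (intMul.comp (hεc.pair hNc))) :)
  have hνi : CodeFP faInE intE (fun p => (p.2.2.1 : ℤ) - p.2.2.2.2.1 * vget p.2.1 p.2.2.2.2.2.2) :=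
    (intSub.comp (hd.pair (intMul.comp (hεi.pair hNi))) :)
  have hz := (zipWith (σ := Unit) (eσ := unitE) (eα := intE) (eβ := intE) (eγ := intE)
    (g := fun t => t.2.1 + t.2.2) (intAdd.comp ((snd _ _).fst'.pair (snd _ _).snd')) :)
  have hv1 : CodeFP faInE vecE (fun p => oneHot p.1 p.2.2.2.2.2.1
      (((p.2.2.1 : ℤ) - p.2.2.2.2.1 * vget p.2.1 p.2.2.2.2.2.2) * p.2.2.2.1 * (p.2.2.1 : ℤ))) :=
    (oneHotFP.comp (hD.pair (hc.pair (intMul.comp ((intMul.comp (hνi.pair hεc)).pair hd)))) :)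
  have hv2 : CodeFP faInE vecE (fun p => oneHot p.1 p.2.2.2.2.2.2
      (-(((p.2.2.1 : ℤ) - p.2.2.2.1 * vget p.2.1 p.2.2.2.2.2.1) * p.2.2.2.2.1 * (p.2.2.1 : ℤ)))) :=
    (oneHotFP.comp (hD.pair (hi.pair (intNeg.comp (intMul.comp ((intMul.comp (hνc.pair hεi)).pair hd))))) :)
  have hcoef := (hz.comp ((const faInE ()).pair (hv1.pair hv2)) :)
  have hconst : CodeFP faInE intE (fun p =>
      -(((p.2.2.1 : ℤ) - p.2.2.2.2.1 * vget p.2.1 p.2.2.2.2.2.2) * p.2.2.2.1 * vget p.2.1 p.2.2.2.2.2.1) +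
        ((p.2.2.1 : ℤ) - p.2.2.2.1 * vget p.2.1 p.2.2.2.2.2.1) * p.2.2.2.2.1 * vget p.2.1 p.2.2.2.2.2.2) :=
    (intAdd.comp ((intNeg.comp (intMul.comp ((intMul.comp (hνi.pair hεc)).pair hNc))).pair
      (intMul.comp ((intMul.comp (hνc.pair hεi)).pair hNi))) :)
  exact ((hcoef.pair hconst :)).congr fun p => by simp only [ufaForm]

/-- Projections of the form input. [folklore] -/
theorem lin_P : CodeFP linE paramsE (fun q : LIn => q.1) := fst _ _
/-- Projection `d` of the form input, on codes. [folklore] -/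
theorem lin_d : CodeFP linE dataE (fun q : LIn => q.2.1) := (snd _ _).fst'
/-- Projection `τ` of the form input, on codes. [folklore] -/
theorem lin_τ : CodeFP linE taskE (fun q : LIn => q.2.2) := (snd _ _).snd'
/-- Projection `cur` of the form input, on codes. [folklore] -/
theorem lin_cur : CodeFP linE scrE (fun q : LIn => q.2.1.cur) := (data_cur.comp lin_d :)

/-- The tag dispatch of `ulocalForm`. [folklore] -/
theorem ulocalForm_eq (P : UParams) (d : UData) (τ : UTask) :
    ulocalForm P d τ =
      if τ.tag = 0 then ubsForm P.D (τ.args.getD 0 0) (min (τ.args.getD 1 0) P.L) (if τ.args.getD 1 0 = 0 then 0 else d.cur.bsAcc)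
      else if τ.tag = 5 then ugeForm P.D d.cur.apexN d.cur.apexD (τ.args.getD 0 0)
      else if τ.tag = 6 then uleForm P.D d.cur.apexN d.cur.apexD (τ.args.getD 0 0)
      else if τ.tag = 7 then
        (match d.cur.cand.toList with
          | [] => (List.replicate P.D 0, 0)
          | c :: _ => ufaForm P.D d.cur.apexN d.cur.apexD (usignAt d.cur.ge d.cur.le c)
              (usignAt d.cur.ge d.cur.le (τ.args.getD 0 0)) c (τ.args.getD 0 0))
      else (List.replicate P.D 0, 0) := by
  cases τ <;> simp only [ulocalForm, UTask.tag, UTask.args] <;> try rfl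
  · cases d.cur.cand <;> rfl

set_option maxHeartbeats 1000000 in
/-- **The level-local form of a task is computed in polynomial time.** [cite: FournierKoiran2000, §2.1] -/
theorem ulocalFormFP : CodeFP linE affE (fun q : LIn => ulocalForm q.1 q.2.1 q.2.2) := by
  have hD : CodeFP linE unE (fun q : LIn => q.1.D) := (params_D.comp lin_P :)
  have hL : CodeFP linE unE (fun q : LIn => q.1.L) := (params_L.comp lin_P :)
  have ha0 : CodeFP linE natE (fun q : LIn => q.2.2.args.getD 0 0) := ((task_arg 0).comp lin_τ :)
  have ha1 : CodeFP linE natE (fun q : LIn => q.2.2.args.getD 1 0) := ((task_arg 1).comp lin_τ :)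
  have htag : ∀ k : ℕ, CodeFP linE bitE (fun q : LIn => decide (q.2.2.tag = k)) := (fun k =>
    natEq.comp ((task_tag.comp lin_τ).pair (const _ k)) :)
  have hN : CodeFP linE vecE (fun q : LIn => q.2.1.cur.apexN) := (scr_apexN.comp lin_cur :)
  have hd : CodeFP linE natE (fun q : LIn => q.2.1.cur.apexD) := (scr_apexD.comp lin_cur :)
  have hge : CodeFP linE (rawE bitE) (fun q : LIn => q.2.1.cur.ge) := (scr_ge.comp lin_cur :)
  have hle : CodeFP linE (rawE bitE) (fun q : LIn => q.2.1.cur.le) := (scr_le.comp lin_cur :)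
  have hzero : CodeFP linE affE (fun q : LIn => (List.replicate q.1.D (0 : ℤ), (0 : ℤ))) :=
    ((zeroVec.comp hD).pair (const _ (0 : ℤ)) :)
  -- `bs`
  have hacc : CodeFP linE natE (fun q : LIn => if q.2.2.args.getD 1 0 = 0 then 0 else q.2.1.cur.bsAcc) :=
    ((natEq.comp (ha1.pair (const _ 0))).ite (const _ 0) (scr_bsAcc.comp lin_cur)).congr fun q => by
      simp only [decide_eq_true_eq]
  have hbs := (ubsFormFP.comp (hD.pair (ha0.pair (ha1.pair (hL.pair hacc)))) :)
  -- `eqGe`, `eqLe`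
  have hgeF := (ugeFormFP.comp (hD.pair (hN.pair (hd.pair ha0))) :)
  have hleF := (uleFormFP.comp (hD.pair (hN.pair (hd.pair ha0))) :)
  -- `fa`: case analysis on the candidate
  have hsig : CodeFP (pairE linE natE) intE (fun t => usignAt t.1.2.1.cur.ge t.1.2.1.cur.le t.2) :=
    (usignAtFP.comp ((hge.comp (fst _ _)).pair ((hle.comp (fst _ _)).pair (snd _ _))) :)
  have hcons : CodeFP (pairE linE (pairE natE (rawE natE))) affE (fun t =>
      ufaForm t.1.1.D t.1.2.1.cur.apexN t.1.2.1.cur.apexD (usignAt t.1.2.1.cur.ge t.1.2.1.cur.le t.2.1)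
        (usignAt t.1.2.1.cur.ge t.1.2.1.cur.le (t.1.2.2.args.getD 0 0)) t.2.1 (t.1.2.2.args.getD 0 0)) :=
    (ufaFormFP.comp ((hD.comp (fst _ _)).pair ((hN.comp (fst _ _)).pair ((hd.comp (fst _ _)).pair
      ((hsig.comp ((fst _ _).pair (snd _ _).fst')).pair ((hsig.comp ((fst _ _).pair (ha0.comp (fst _ _)))).pair
        ((snd _ _).fst'.pair (ha0.comp (fst _ _)))))))) :)
  have hcandL : CodeFP linE (rawE natE) (fun q : LIn => q.2.1.cur.cand.toList) :=
    ((ofView (eα := optE natE) (eγ := rawE natE) (t := Option.toList) (fun _ => rfl) (CodeFP.id _)).comp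
      (scr_cand.comp lin_cur) :)
  have hfa := ((rawCases (eσ := linE) (eα := natE) (σ := LIn)
    (k := fun (q : LIn) (l : List ℕ) => match l with
      | [] => (List.replicate q.1.D (0 : ℤ), (0 : ℤ))
      | c :: _ => ufaForm q.1.D q.2.1.cur.apexN q.2.1.cur.apexD (usignAt q.2.1.cur.ge q.2.1.cur.le c)
          (usignAt q.2.1.cur.ge q.2.1.cur.le (q.2.2.args.getD 0 0)) c (q.2.2.args.getD 0 0))
    hzero hcons (fun _ => rfl) (fun _ _ _ => rfl)).comp ((CodeFP.id linE).pair hcandL) :)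
  refine ((((htag 0).ite hbs ((htag 5).ite hgeF ((htag 6).ite hleF ((htag 7).ite hfa hzero))) :)).congr fun q => ?_)
  rw [ulocalForm_eq]
  simp only [decide_eq_true_eq, id]

/-- The apex history of a state. [folklore] -/
theorem uhistFP : CodeFP dataE (rawE apexE) UData.hist :=
  ((map₀ (lrec_apexN.pair (lrec_apexD.pair (lrec_istar.pair lrec_εstar)))).comp data_levels :).congr fun _ => rfl

/-- **The queried form is computed in polynomial time.** [cite: FournierKoiran2000, §2.1 Step k] -/
theorem uqueryFormFP : CodeFP linE affE (fun q : LIn => uqueryForm q.1 q.2.1 q.2.2) :=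
  (uliftAllFP.comp (ulocalFormFP.pair (uhistFP.comp lin_d)) :).congr fun _ => rfl

/-- The affine sign query handed to the sign oracle of `x ∈ ℝⁿ` for a homogeneous form on
`x̂ = (x, 1) ∈ ℝ^{n+1}`: constant `a_n + c`, coefficients `a_0, …, a_{n-1}`, in the list format
read by `affineQueryValue`, tagged `0`. [cite: FournierKoiran2000, §2 (the model), Thm 3] -/
def squery (n : ℕ) (φ : UAff) : List Bool := false :: listE smE ((vget φ.1 n + φ.2) :: φ.1.take n)

/-- **The sign query is computed in polynomial time** from `1ⁿ` and the form. [folklore] -/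
theorem squeryFP : CodeFP (pairE unE affE) strE (fun p => squery p.1 p.2) := by
  have hn : CodeFP (pairE unE affE) unE (fun p => p.1) := fst _ _
  have ha : CodeFP (pairE unE affE) vecE (fun p => p.2.1) := (snd _ _).fst'
  have hc : CodeFP (pairE unE affE) intE (fun p => p.2.2) := (snd _ _).snd'
  have hl : CodeFP (pairE unE affE) vecE (fun p => (vget p.2.1 p.1 + p.2.2) :: p.2.1.take p.1) :=
    ((rawCons intE).comp ((intAdd.comp ((vgetFP.comp (ha.pair (natOfUn.comp hn))).pair hc)).pair
      ((rawTakeUn intE).comp (hn.pair ha))) :)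
  have hsm : CodeFP (pairE unE affE) (listE smE) (fun p => (vget p.2.1 p.1 + p.2.2) :: p.2.1.take p.1) :=
    ((listOfRaw smE).comp ((map₀ smOfInt).comp hl) :).congr fun p => by simp
  obtain ⟨f, hf, hfe⟩ := hsm
  exact ⟨List.cons false ∘ f, comp_mem_FP (cons_mem_FP false) hf, fun p => by
    rw [Function.comp_apply, hfe]; rfl⟩

end Local

end FKPointLocation

end Literature.Computability.Complexity
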